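import Mathlib.Analysis.Fourier.ZMod
import Mathlib.Analysis.Complex.Trigonometric
import HarnessLib

/-!
# Summation by parts for the discrete Fourier transform on `ℤ/Lℤ` (lattice propagator decay)

Topic `Literature/Analysis/Fourier`.  On a finite periodic lattice the decay of a single-scale
propagator is obtained "by integrating by parts … where `∂_k` denote the discrete derivatives"
(Mastropietro 2008, Lemma 3.2 and (3.19):
`d_L(x)^{N} g^{(h)}(x) = e^{-iπxN/L} (-i)^N L^{-1} Σ_k e^{-ikx} ∂_k^N [f_h(k) ĝ(k)]`,
`d_L(x) = sin (πx/L)`; Benfatto–Giuliani–Mastropietro 2006, (2.50) and App. A1).  This file proves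
the underlying identity and bound for the discrete Fourier sum `ǧ(x) = Σ_k ψ(kx) ĝ(k)` on `ZMod L`
with the standard additive character `ψ(j) = e^{2πij/L}`:

* `idft_eq_dft_neg`, `idft_eq_natCast_mul_invDFT` — `ǧ(x) = 𝓕 ĝ (-x) = L · 𝓕⁻ ĝ (x)` in terms of
  Mathlib's `ZMod.dft`, so that its inversion/Parseval API applies;
* `sub_one_mul_idft` — `(ψ(x) - 1) ǧ(x) = (Δĝ)ˇ(x)` with the backward difference
  `Δĝ(k) = ĝ(k-1) - ĝ(k)`; `sub_one_pow_mul_idft` — iterated, `(ψ(x) - 1)^N ǧ(x) = (Δᴺĝ)ˇ(x)`;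
* `norm_idft_le` — `‖ǧ(x)‖ ≤ Σ_k ‖ĝ(k)‖`; `norm_stdAddChar_sub_one` — `‖ψ(x) - 1‖ = 2|sin(πx/L)|`;
* `pow_mul_norm_idft_le` — **the lattice decay bound**
  `(2|sin(πx/L)|)^N ‖ǧ(x)‖ ≤ Σ_k ‖Δᴺĝ(k)‖`.

Everything is proved; no named fact. [folklore]

## Sources

V. Mastropietro, *Non-Perturbative Renormalization* (2008), §3.2, Lemma 3.2, (3.18)–(3.19), PDF
pp. 54–55 of the held copy (`Mastropietro2008`); G. Benfatto, A. Giuliani, V. Mastropietro, Ann.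
Henri Poincaré 7 (2006), (2.50) (`BenfattoGiulianiMastropietro2006`).
-/

noncomputable section

open Finset Complex

namespace Literature.Analysis.Fourier

variable {L : ℕ} [NeZero L]

/-- The discrete Fourier sum `ǧ(x) = Σ_k ψ(kx) ĝ(k)` on `ℤ/Lℤ`, `ψ(j) = e^{2πij/L}`. [folklore] -/
def idft (ĝ : ZMod L → ℂ) (x : ZMod L) : ℂ :=
  ∑ k, ZMod.stdAddChar (k * x) * ĝ k

/-- **`idft` is Mathlib's discrete Fourier transform** `ZMod.dft` evaluated at `-x`:
`ǧ(x) = 𝓕 ĝ (-x)`. [folklore] -/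
theorem idft_eq_dft_neg (ĝ : ZMod L → ℂ) (x : ZMod L) : idft ĝ x = ZMod.dft ĝ (-x) := by
  rw [ZMod.dft_apply, idft]
  simp only [mul_neg, neg_neg, smul_eq_mul]

/-- … and `L` times Mathlib's inverse discrete Fourier transform: `ǧ(x) = L · 𝓕⁻ ĝ (x)`. [folklore] -/
theorem idft_eq_natCast_mul_invDFT (ĝ : ZMod L → ℂ) (x : ZMod L) :
    idft ĝ x = (L : ℂ) * (ZMod.dft (N := L)).symm ĝ x := by
  rw [ZMod.invDFT_apply', idft_eq_dft_neg, smul_eq_mul, ← mul_assoc,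
    mul_inv_cancel₀ (Nat.cast_ne_zero.2 (NeZero.ne L)), one_mul]

/-- The backward difference `Δĝ(k) = ĝ(k-1) - ĝ(k)` ("discrete derivative"). [folklore] -/
def bdiff (ĝ : ZMod L → ℂ) (k : ZMod L) : ℂ :=
  ĝ (k - 1) - ĝ k

/-- **Summation by parts**: `(ψ(x) - 1) ǧ(x) = (Δĝ)ˇ(x)`. [folklore] -/
theorem sub_one_mul_idft (ĝ : ZMod L → ℂ) (x : ZMod L) :
    (ZMod.stdAddChar x - 1) * idft ĝ x = idft (bdiff ĝ) x := by
  unfold idft bdiff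
  simp only [mul_sub, sum_sub_distrib, sub_mul, one_mul, mul_sum]
  congr 1
  rw [← (Equiv.subRight (1 : ZMod L)).sum_comp]
  refine sum_congr rfl fun k _ => ?_
  simp only [Equiv.subRight_apply]
  rw [← mul_assoc, ← AddChar.map_add_eq_mul, sub_one_mul, add_sub_cancel]

/-- Iterated summation by parts: `(ψ(x) - 1)^N ǧ(x) = (Δᴺĝ)ˇ(x)`. [folklore] -/
theorem sub_one_pow_mul_idft (ĝ : ZMod L → ℂ) (x : ZMod L) (N : ℕ) :
    (ZMod.stdAddChar x - 1) ^ N * idft ĝ x = idft (bdiff^[N] ĝ) x := by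
  induction N generalizing ĝ with
  | zero => rw [pow_zero, one_mul, Function.iterate_zero, id]
  | succ N ih => rw [pow_succ, mul_assoc, sub_one_mul_idft, ih, ← Function.iterate_succ_apply]

/-- `‖ψ(j)‖ = 1`. [folklore] -/
theorem norm_stdAddChar (j : ZMod L) : ‖(ZMod.stdAddChar j : ℂ)‖ = 1 := by
  rw [ZMod.stdAddChar_apply, Circle.norm_coe]

/-- `‖ǧ(x)‖ ≤ Σ_k ‖ĝ(k)‖`. [folklore] -/
theorem norm_idft_le (ĝ : ZMod L → ℂ) (x : ZMod L) : ‖idft ĝ x‖ ≤ ∑ k, ‖ĝ k‖ := by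
  refine (norm_sum_le _ _).trans (sum_le_sum fun k _ => ?_)
  rw [norm_mul, norm_stdAddChar, one_mul]

/-- `‖ψ(x) - 1‖ = 2 |sin (π x/L)|` (`x` represented by `x.val ∈ [0, L)`). [folklore] -/
theorem norm_stdAddChar_sub_one (x : ZMod L) :
    ‖(ZMod.stdAddChar x : ℂ) - 1‖ = 2 * |Real.sin (Real.pi * x.val / L)| := by
  rw [ZMod.stdAddChar_apply, ZMod.toCircle_apply]
  have h : (2 * Real.pi * I * (x.val : ℂ) / (L : ℂ) : ℂ) = I * ((2 * Real.pi * x.val / L : ℝ) : ℂ) := by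
    push_cast; ring
  rw [h, Complex.norm_exp_I_mul_ofReal_sub_one, Real.norm_eq_abs, abs_mul, abs_two]
  congr 2
  ring

/-- **The lattice decay bound** (Mastropietro 2008, (3.19)): `(2|sin(πx/L)|)^N ‖ǧ(x)‖ ≤ Σ_k ‖Δᴺĝ(k)‖`
— each discrete derivative of a momentum function varying on the scale `γʰ` costs `γ^{-h}/L`-many
lattice steps' worth, whence the decay `(1 + γʰ d_L(x))^{-N}` of the single-scale propagator. [cite: Mastropietro2008, Lemma 3.2 (3.19)] -/
theorem pow_mul_norm_idft_le (ĝ : ZMod L → ℂ) (x : ZMod L) (N : ℕ) :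
    (2 * |Real.sin (Real.pi * x.val / L)|) ^ N * ‖idft ĝ x‖ ≤ ∑ k, ‖(bdiff^[N] ĝ) k‖ := by
  rw [← norm_stdAddChar_sub_one, ← norm_pow, ← norm_mul, sub_one_pow_mul_idft]
  exact norm_idft_le _ x

end Literature.Analysis.Fourier
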